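import Literature.MathematicalPhysics.QuantumFieldTheory.Balaban1983to89.T4LipschitzLedger
import Literature.MathematicalPhysics.QuantumFieldTheory.Balaban1983to89.T4RecentScale

/-!
# T⁴ programme, spine node NE7c (U5b) — ROAD P3 «SMOOTHING», the PERFORMED-LETTER LIPSCHITZ LEMMA: a pending (inner)
# integral carrying a Lipschitz-profiled letter is two-run sandwiched from (rest sandwich) + (sup-closeness) + (plateau
# floor), with NO anti-concentration input

Cell `pub-balaban`, BINDER-OWNERS row NE7c, co-owner #3 = unit `b2b-balaban-t4-ne7c-p3`, skeleton
`HOME/t4/skeletons/NE7c-t4-ne7c-p3.md` offer (x3) ∕ leaf L12.  Companion of `Spine/NE7cSmoothing` (p206673).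

THE QUESTION IT SERVES (located, not this row's): cell GAPS G-ne7cp2-9 ∕ `t4/T4-EST-U5bE2.md` §27.5 Lq-27.3 — background-
mediated letters of INTERMEDIATE ages (older than the live window, younger than row NE7b's good-class cut) sit INSIDE
PERFORMED pending operations of a good term, i.e. inside node U5b's two-run remainder sandwich `hsw`, not in the shell
weight R.  Record `t4/T4-EST-NE7c-P1.md` (gen 13, device (π)) typed the SHARP-letter version: the performed values
`∫_{u^X < θ} G^X dν` of the two runs are two-sided close given (1) the rest sandwich, (2) a FIBREWISE anti-concentration
(M1) of the letter's variable under `G^A dν` — NOT PRINTED —, (3) a fibrewise small-field FLOOR, (4) sup-closeness.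
THIS MODULE: if the letter is a Lipschitz PROFILE `χ(u^X/θ)` of fixed width `κ` (road P3's design, extended to that
letter), input (2) DISAPPEARS.  Precisely (§2 `perf_sandwich`): for `F^X = ∫ χ(u^X/θ)·G^X dν` with
`|u^A − u^B| ≤ ρθ` ν-a.e., `e^{c−r}G^A ≤ G^B ≤ e^{c+r}G^A` ν-a.e. (`G^A ≥ 0`), and the PLATEAU FLOOR
`f · ∫ 1[u^A < (1+ρ)θ]·G^A ≤ F^A` (`0 < f`; implied by the sharp form `f·∫ 1[u^A < (1+ρ)θ]·G^A ≤ ∫ 1[u^A < (1−κ)θ]·G^A`,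
§2 `plateauFloor_of_sharp` — «the deep small-field region carries at least the fraction f of the near-small-field
weight», a large-field SMALLNESS of the printed KIND [Balaban1989LargeFieldII] (1.89) p. 387, never asserted here),
  `e^{c−r}·(1 − Lρ/f)·F^A ≤ F^B ≤ e^{c+r}·(1 + Lρ/f)·F^A`,
and (§3) in node U5b's currency `T4RecentScale.FactorSandwich` with the radius `r + log(f/(f − Lρ))` (`Lρ < f`),
`log(f/(f − Lρ)) ≤ Lρ/(f − Lρ)` — a RATE in the letter's level through `ρ = ρ_j`, summable when `ρ` is.  §4 (v1.1, append-only):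
the NORMALISED carrier `(∫χG)/(∫χH)` (the `(T′1)⁻¹T′` TYPE of (1.103)) — `perf_ratio_sandwich`, radius doubled, floor twice.  §1 is the
pointwise heart: `|χ(u^A/θ) − χ(u^B/θ)| ≤ Lρ · 1[u^A < (1+ρ)θ]` (the mismatch lives on the near-small-field region of run
A and is `Lρ`-small there — deterministic).

HONEST FRAMING.  Kernel bookkeeping over abstract measure spaces ([folklore]; 0 sorry); NOTHING of Bałaban's asserted;
every input a displayed binder: the rest sandwich is node U5b's, the closeness is node U1b's (NE3 species), the plateau
floor is a located large-field smallness (binder), the profile is road P3's DESIGN (not print's procedure: print's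
letters are sharp, B14 (2.17) p. 257).  Whether the cell extends profiles beyond the live window is a DESIGN QUESTION for
the U5 referee ∕ the node owner (skeleton §4, recorded, not decided here).  FIXED finite T⁴, rung (B)+1; NOT infinite
volume, NOT a mass gap, NOT Clay, NOT summit progress; spine 0/9 unchanged.  HONEST DEPENDENCY: continuum YM on T⁴ ⇐
BetaPertH ∧ nine spine estimates (0/9 proved); BetaPertH ⇐ (D1) ∧ (D4) ∧ CAP+tail; G-an2-4 gates asym, D1 and NE2/3/4.
-/

noncomputable section

open MeasureTheory Finset Filter Topology
open scoped NNReal ENNReal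

namespace Summit.QuantumFields.BalabanUV.T4Continuum.NE7cSmoothingPerformed

open Literature.MathematicalPhysics.QuantumFieldTheory.Balaban1983to89
open T4IndicatorShell T4LipschitzCutoff T4LipschitzLedger T4RecentScale

/-! ## §1 Pointwise: the profiled mismatch is `Lρ`-small and lives on run A's near-small-field region -/

/-- **THE PROFILED MISMATCH, LOCALISED.**  For a Lipschitz profile, `θ > 0`, `0 ≤ ρ` and `|u^A − u^B| ≤ ρθ`:
`|χ(u^A/θ) − χ(u^B/θ)| ≤ L·ρ·1[u^A < (1+ρ)θ]` — above `(1+ρ)θ` both factors vanish (`u^B ≥ θ`), below it the Lipschitz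
bound `T4LipschitzCutoff.abs_profile_sub_profile_le` applies. [folklore] -/
theorem abs_profile_sub_le_near {χ : ℝ → ℝ} {κ L : ℝ} (h : LipProfile χ κ L) {θ : ℝ} (hθ : 0 < θ) {uA uB ρ : ℝ}
    (hρ : 0 ≤ ρ) (hΔ : |uA - uB| ≤ ρ * θ) :
    |χ (uA / θ) - χ (uB / θ)| ≤ L * ρ * smallInd uA ((1 + ρ) * θ) := by
  unfold smallInd
  split_ifs with hu
  · rw [mul_one]
    have := h.abs_profile_sub_profile_le hθ hΔ
    rwa [mul_div_assoc, div_self hθ.ne', mul_one] at this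
  · -- both factors vanish
    have hA : 1 ≤ uA / θ := by
      rw [le_div_iff₀ hθ, one_mul]
      have : θ ≤ (1 + ρ) * θ := by nlinarith
      exact this.trans (not_lt.1 hu)
    have hB : 1 ≤ uB / θ := by
      rw [le_div_iff₀ hθ, one_mul]
      have h1 := (abs_sub_le_iff.1 hΔ).1
      have : (1 + ρ) * θ ≤ uA := not_lt.1 hu
      nlinarith
    rw [h.eq_zero _ hA, h.eq_zero _ hB, sub_self, abs_zero, mul_zero]

/-- One-sided forms: `χ(u^B/θ) ≤ χ(u^A/θ) + Lρ·1[u^A < (1+ρ)θ]` … [folklore] -/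
theorem profile_le_profile_add_near {χ : ℝ → ℝ} {κ L : ℝ} (h : LipProfile χ κ L) {θ : ℝ} (hθ : 0 < θ)
    {uA uB ρ : ℝ} (hρ : 0 ≤ ρ) (hΔ : |uA - uB| ≤ ρ * θ) :
    χ (uB / θ) ≤ χ (uA / θ) + L * ρ * smallInd uA ((1 + ρ) * θ) := by
  have h1 := abs_profile_sub_le_near h hθ hρ hΔ
  have h2 := (abs_sub_le_iff.1 h1).2
  linarith

/-- … and `χ(u^A/θ) − Lρ·1[u^A < (1+ρ)θ] ≤ χ(u^B/θ)`. [folklore] -/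
theorem profile_sub_near_le_profile {χ : ℝ → ℝ} {κ L : ℝ} (h : LipProfile χ κ L) {θ : ℝ} (hθ : 0 < θ)
    {uA uB ρ : ℝ} (hρ : 0 ≤ ρ) (hΔ : |uA - uB| ≤ ρ * θ) :
    χ (uA / θ) - L * ρ * smallInd uA ((1 + ρ) * θ) ≤ χ (uB / θ) := by
  have h1 := abs_profile_sub_le_near h hθ hρ hΔ
  have h2 := (abs_sub_le_iff.1 h1).1
  linarith

/-! ## §2 The performed factor, the plateau floor, and THE LEMMA -/

section Performed

variable {Ω : Type*} [MeasurableSpace Ω] {ν : Measure Ω}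

/-! Vocabulary (inlined, no definitions): the PERFORMED VALUE of a profiled letter is `∫ ω, χ (u ω / θ) * G ω ∂ν`
(a pending positive integral operation applied to an integrand carrying the letter; cf. [Balaban1989LargeFieldII]
(1.73)–(1.75) p. 380 for the printed normalised operations — TEMPLATE only); the NEAR-SMALL-FIELD MASS of run A's letter
is `∫ ω, smallInd (u ω) ((1 + ρ) * θ) * G ω ∂ν`; the DEEP-SMALL-FIELD MASS (the profile's plateau) is
`∫ ω, smallInd (u ω) ((1 - κ) * θ) * G ω ∂ν`. -/

omit [MeasurableSpace Ω] in
/-- measurability of a sharp small-field indicator of a measurable variable. [folklore] -/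
theorem measurable_smallInd_comp {m : MeasurableSpace Ω} {u : Ω → ℝ} (hu : Measurable u) (t : ℝ) :
    Measurable fun ω => smallInd (u ω) t := by
  unfold smallInd
  refine Measurable.ite ?_ measurable_const measurable_const
  exact measurableSet_lt hu measurable_const

/-- measurability of a profile factor of a measurable variable. [folklore] -/
theorem measurable_profile_comp {χ : ℝ → ℝ} {κ L : ℝ} (h : LipProfile χ κ L) {u : Ω → ℝ} (hu : Measurable u)
    (θ : ℝ) : Measurable fun ω => χ (u ω / θ) :=
  (continuous_profile h).measurable.comp (hu.div_const θ)

variable {χ : ℝ → ℝ} {κ L θ ρ f c r : ℝ} {uA uB GA GB : Ω → ℝ}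

/-- **THE PLATEAU FLOOR FROM ITS SHARP FORM.**  If the deep small-field region `{u^A < (1−κ)θ}` carries at least the
fraction `f` of the near-small-field weight `∫ 1[u^A < (1+ρ)θ]·G^A`, then the plateau floor holds (the profile is `1` on the
deep region: `T4LipschitzCutoff.smallInd_le_profile`). [folklore] -/
theorem plateauFloor_of_sharp (h : LipProfile χ κ L) (hθ : 0 < θ) (huA : Measurable uA) (hGA : Integrable GA ν)
    (hGA0 : 0 ≤ᵐ[ν] GA) (hfl : f * (∫ ω, smallInd (uA ω) ((1 + ρ) * θ) * GA ω ∂ν) ≤ (∫ ω, smallInd (uA ω) ((1 - κ) * θ) * GA ω ∂ν)) :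
    f * (∫ ω, smallInd (uA ω) ((1 + ρ) * θ) * GA ω ∂ν) ≤ (∫ ω, χ (uA ω / θ) * GA ω ∂ν) := by
  refine hfl.trans ?_
  refine integral_mono_ae ?_ ?_ ?_
  · exact integrable_unitInterval_mul hGA (measurable_smallInd_comp huA _) (fun ω => smallInd_nonneg _ _)
      fun ω => smallInd_le_one _ _
  · exact integrable_unitInterval_mul hGA (measurable_profile_comp h huA θ) (fun ω => h.nonneg _) fun ω => h.le_one _
  · filter_upwards [hGA0] with ω hω
    exact mul_le_mul_of_nonneg_right (h.smallInd_le_profile hθ (uA ω)) hω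

/-- **THE PERFORMED-LETTER LIPSCHITZ LEMMA.**  Rest sandwich `e^{c−r}G^A ≤ G^B ≤ e^{c+r}G^A` a.e. (`G^A ≥ 0` a.e., both
integrable), sup-closeness `|u^A − u^B| ≤ ρθ` a.e., a Lipschitz profile of constant `L`, and the plateau floor
`f·∫ 1[u^A<(1+ρ)θ]G^A ≤ ∫ χ(u^A/θ)G^A` with `0 < f` ⇒
`e^{c−r}(1 − Lρ/f)·perf^A ≤ perf^B ≤ e^{c+r}(1 + Lρ/f)·perf^A`.  No law of `u`, no anti-concentration. [folklore] -/
theorem perf_sandwich (h : LipProfile χ κ L) (hθ : 0 < θ) (hρ : 0 ≤ ρ)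
    (huA : Measurable uA) (huB : Measurable uB) (hGA : Integrable GA ν) (hGB : Integrable GB ν) (hGA0 : 0 ≤ᵐ[ν] GA)
    (hclose : ∀ᵐ ω ∂ν, |uA ω - uB ω| ≤ ρ * θ)
    (hlo : ∀ᵐ ω ∂ν, Real.exp (c - r) * GA ω ≤ GB ω) (hhi : ∀ᵐ ω ∂ν, GB ω ≤ Real.exp (c + r) * GA ω)
    (hf : 0 < f) (hfloor : f * (∫ ω, smallInd (uA ω) ((1 + ρ) * θ) * GA ω ∂ν) ≤ (∫ ω, χ (uA ω / θ) * GA ω ∂ν)) :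
    Real.exp (c - r) * (1 - L * ρ / f) * (∫ ω, χ (uA ω / θ) * GA ω ∂ν) ≤ (∫ ω, χ (uB ω / θ) * GB ω ∂ν) ∧
      (∫ ω, χ (uB ω / θ) * GB ω ∂ν) ≤ Real.exp (c + r) * (1 + L * ρ / f) * (∫ ω, χ (uA ω / θ) * GA ω ∂ν) := by
  -- abbreviations
  set PA := (∫ ω, χ (uA ω / θ) * GA ω ∂ν) with hPA
  set PB := (∫ ω, χ (uB ω / θ) * GB ω ∂ν) with hPB
  set M := (∫ ω, smallInd (uA ω) ((1 + ρ) * θ) * GA ω ∂ν) with hM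
  -- the cross term: run B's letter against run A's rest
  set Q := ∫ ω, χ (uB ω / θ) * GA ω ∂ν with hQ
  have hL0 : 0 ≤ L := h.L_pos.le
  -- integrability facts
  have hIBA : Integrable (fun ω => χ (uB ω / θ) * GA ω) ν :=
    integrable_unitInterval_mul hGA (measurable_profile_comp h huB θ) (fun ω => h.nonneg _) fun ω => h.le_one _
  have hIBB : Integrable (fun ω => χ (uB ω / θ) * GB ω) ν :=
    integrable_unitInterval_mul hGB (measurable_profile_comp h huB θ) (fun ω => h.nonneg _) fun ω => h.le_one _
  have hIAA : Integrable (fun ω => χ (uA ω / θ) * GA ω) ν :=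
    integrable_unitInterval_mul hGA (measurable_profile_comp h huA θ) (fun ω => h.nonneg _) fun ω => h.le_one _
  have hIM : Integrable (fun ω => smallInd (uA ω) ((1 + ρ) * θ) * GA ω) ν :=
    integrable_unitInterval_mul hGA (measurable_smallInd_comp huA _) (fun ω => smallInd_nonneg _ _)
      fun ω => smallInd_le_one _ _
  -- Step 1: the rest sandwich passes through the common nonnegative factor χ(u^B/θ)
  have h1 : Real.exp (c - r) * Q ≤ PB ∧ PB ≤ Real.exp (c + r) * Q :=
    integral_mul_sandwich (fun ω => h.nonneg _) hIBA hIBB hlo hhi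
  -- Step 2: |Q − PA| ≤ Lρ·M
  have h2u : Q ≤ PA + L * ρ * M := by
    have : Q ≤ ∫ ω, (χ (uA ω / θ) * GA ω + L * ρ * (smallInd (uA ω) ((1 + ρ) * θ) * GA ω)) ∂ν := by
      refine integral_mono_ae hIBA (hIAA.add (hIM.const_mul _)) ?_
      filter_upwards [hclose, hGA0] with ω hω hG
      have := profile_le_profile_add_near h hθ hρ hω
      calc χ (uB ω / θ) * GA ω ≤ (χ (uA ω / θ) + L * ρ * smallInd (uA ω) ((1 + ρ) * θ)) * GA ω :=
            mul_le_mul_of_nonneg_right this hG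
        _ = χ (uA ω / θ) * GA ω + L * ρ * (smallInd (uA ω) ((1 + ρ) * θ) * GA ω) := by ring
    rw [integral_add hIAA (hIM.const_mul _), integral_const_mul] at this
    exact this
  have h2l : PA - L * ρ * M ≤ Q := by
    have : ∫ ω, (χ (uA ω / θ) * GA ω - L * ρ * (smallInd (uA ω) ((1 + ρ) * θ) * GA ω)) ∂ν ≤ Q := by
      refine integral_mono_ae (hIAA.sub (hIM.const_mul _)) hIBA ?_
      filter_upwards [hclose, hGA0] with ω hω hG
      have := profile_sub_near_le_profile h hθ hρ hω
      calc χ (uA ω / θ) * GA ω - L * ρ * (smallInd (uA ω) ((1 + ρ) * θ) * GA ω)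
          = (χ (uA ω / θ) - L * ρ * smallInd (uA ω) ((1 + ρ) * θ)) * GA ω := by ring
        _ ≤ χ (uB ω / θ) * GA ω := mul_le_mul_of_nonneg_right this hG
    rw [integral_sub hIAA (hIM.const_mul _), integral_const_mul] at this
    exact this
  -- Step 3: the floor turns M into PA/f
  have hM' : L * ρ * M ≤ L * ρ / f * PA := by
    have hMle : M ≤ PA / f := by
      rw [le_div_iff₀ hf, mul_comm]; exact hfloor
    calc L * ρ * M ≤ L * ρ * (PA / f) := mul_le_mul_of_nonneg_left hMle (mul_nonneg hL0 hρ)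
      _ = L * ρ / f * PA := by ring
  have hQu : Q ≤ (1 + L * ρ / f) * PA := by linarith
  have hQl : (1 - L * ρ / f) * PA ≤ Q := by linarith
  -- Step 4: combine
  constructor
  · calc Real.exp (c - r) * (1 - L * ρ / f) * PA = Real.exp (c - r) * ((1 - L * ρ / f) * PA) := by ring
      _ ≤ Real.exp (c - r) * Q := mul_le_mul_of_nonneg_left hQl (Real.exp_pos _).le
      _ ≤ PB := h1.1
  · calc PB ≤ Real.exp (c + r) * Q := h1.2
      _ ≤ Real.exp (c + r) * ((1 + L * ρ / f) * PA) := mul_le_mul_of_nonneg_left hQu (Real.exp_pos _).le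
      _ = Real.exp (c + r) * (1 + L * ρ / f) * PA := by ring

/-- The elementary radius estimate: for `0 ≤ x < f`, `1 + x/f ≤ f/(f − x)` (so ONE symmetric log-radius `log(f/(f−x))`
serves both sides of `perf_sandwich`). [folklore] -/
theorem one_add_div_le_div_sub {x f : ℝ} (hf : 0 < f) (hx0 : 0 ≤ x) (hx : x < f) : 1 + x / f ≤ f / (f - x) := by
  have hfx : 0 < f - x := sub_pos.2 hx
  rw [show 1 + x / f = (f + x) / f by field_simp, div_le_div_iff₀ hf hfx]
  nlinarith [sq_nonneg x]

/-- … and `1 − x/f = (f − x)/f = (f/(f − x))⁻¹`. [folklore] -/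
theorem one_sub_div_eq_inv {x f : ℝ} (hf : 0 < f) (hx : x < f) : 1 - x / f = (f / (f - x))⁻¹ := by
  have hfx : 0 < f - x := sub_pos.2 hx
  rw [inv_div]
  field_simp

/-- `log(f/(f − x)) ≤ x/(f − x)` for `0 ≤ x < f` (`Real.log_le_sub_one_of_pos`): the radius is a RATE in `x = Lρ`.
[folklore] -/
theorem log_div_sub_le {x f : ℝ} (hf : 0 < f) (hx : x < f) :
    Real.log (f / (f - x)) ≤ x / (f - x) := by
  have hfx : 0 < f - x := sub_pos.2 hx
  have hpos : 0 < f / (f - x) := div_pos hf hfx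
  calc Real.log (f / (f - x)) ≤ f / (f - x) - 1 := Real.log_le_sub_one_of_pos hpos
    _ = x / (f - x) := by field_simp; ring

/-- **THE LEMMA IN EXPONENTIAL-RADIUS FORM**: with `Lρ < f`, `e^{c − (r + log(f/(f−Lρ)))}·perf^A ≤ perf^B ≤
e^{c + (r + log(f/(f−Lρ)))}·perf^A`. [folklore] -/
theorem perf_sandwich_exp (h : LipProfile χ κ L) (hθ : 0 < θ) (hρ : 0 ≤ ρ)
    (huA : Measurable uA) (huB : Measurable uB) (hGA : Integrable GA ν) (hGB : Integrable GB ν) (hGA0 : 0 ≤ᵐ[ν] GA)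
    (hclose : ∀ᵐ ω ∂ν, |uA ω - uB ω| ≤ ρ * θ)
    (hlo : ∀ᵐ ω ∂ν, Real.exp (c - r) * GA ω ≤ GB ω) (hhi : ∀ᵐ ω ∂ν, GB ω ≤ Real.exp (c + r) * GA ω)
    (hf : 0 < f) (hLρ : L * ρ < f) (hfloor : f * (∫ ω, smallInd (uA ω) ((1 + ρ) * θ) * GA ω ∂ν) ≤ (∫ ω, χ (uA ω / θ) * GA ω ∂ν)) :
    Real.exp (c - (r + Real.log (f / (f - L * ρ)))) * (∫ ω, χ (uA ω / θ) * GA ω ∂ν) ≤ (∫ ω, χ (uB ω / θ) * GB ω ∂ν) ∧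
      (∫ ω, χ (uB ω / θ) * GB ω ∂ν) ≤ Real.exp (c + (r + Real.log (f / (f - L * ρ)))) * (∫ ω, χ (uA ω / θ) * GA ω ∂ν) := by
  obtain ⟨hl, hu⟩ := perf_sandwich h hθ hρ huA huB hGA hGB hGA0 hclose hlo hhi hf hfloor
  have hx0 : 0 ≤ L * ρ := mul_nonneg h.L_pos.le hρ
  have hfx : 0 < f - L * ρ := sub_pos.2 hLρ
  have hq : 0 < f / (f - L * ρ) := div_pos hf hfx
  have hPA0 : 0 ≤ (∫ ω, χ (uA ω / θ) * GA ω ∂ν) := by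
    refine integral_nonneg_of_ae ?_
    filter_upwards [hGA0] with ω hω
    exact mul_nonneg (h.nonneg _) hω
  constructor
  · -- lower: e^{c−r}·(f/(f−Lρ))⁻¹ = e^{c−r}(1 − Lρ/f)
    have e1 : Real.exp (c - (r + Real.log (f / (f - L * ρ)))) = Real.exp (c - r) * (1 - L * ρ / f) := by
      rw [one_sub_div_eq_inv hf hLρ, show c - (r + Real.log (f / (f - L * ρ))) =
        (c - r) + (-Real.log (f / (f - L * ρ))) by ring, Real.exp_add, Real.exp_neg, Real.exp_log hq]
    rw [e1]; exact hl
  · -- upper: e^{c+r}(1 + Lρ/f) ≤ e^{c+r}·(f/(f−Lρ))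
    have e2 : Real.exp (c + (r + Real.log (f / (f - L * ρ)))) = Real.exp (c + r) * (f / (f - L * ρ)) := by
      rw [show c + (r + Real.log (f / (f - L * ρ))) = (c + r) + Real.log (f / (f - L * ρ)) by ring, Real.exp_add,
        Real.exp_log hq]
    rw [e2]
    refine hu.trans ?_
    have := one_add_div_le_div_sub hf hx0 hLρ
    calc Real.exp (c + r) * (1 + L * ρ / f) * (∫ ω, χ (uA ω / θ) * GA ω ∂ν)
        ≤ Real.exp (c + r) * (f / (f - L * ρ)) * (∫ ω, χ (uA ω / θ) * GA ω ∂ν) :=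
          mul_le_mul_of_nonneg_right (mul_le_mul_of_nonneg_left this (Real.exp_pos _).le) hPA0
      _ = Real.exp (c + r) * (f / (f - L * ρ)) * (∫ ω, χ (uA ω / θ) * GA ω ∂ν) := rfl

end Performed

/-! ## §3 In node U5b's currency: a ledger of profiled performed factors is a `T4RecentScale.FactorSandwich` with the
radius enlarged by `log(f/(f − Lρ)) ≤ Lρ/(f − Lρ)` -/

section Ledger

variable {ι V : Type*} {X : ι → Type*} [∀ i, MeasurableSpace (X i)] {ν : ∀ i, Measure (X i)}
  {Adm : Set V} {fac : Finset ι} {χ : ι → ℝ → ℝ} {κ L θ ρ f c r : ι → ℝ}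
  {uA uB GA GB : ∀ i, V → X i → ℝ}

/-- **PROFILED PERFORMED FACTORS ARE SANDWICHED FACTORS.**  If every factor `i ∈ fac` of the two runs is the performed
value of a letter with profile `χ i` (width `κ i`, Lipschitz `L i`, threshold `θ i > 0`) against rests `G^A_i`, `G^B_i`
that are sandwiched a.e. with `(c i, r i)` on `Adm`, the letters' variables are `ρ i · θ i`-close a.e., and run A's
plateau floor holds with `f i > L i · ρ i`, then the performed factors form a `FactorSandwich` on `Adm` with constants
`c i` and radii `r i + log(f i/(f i − L i ρ i))` — the input shape of `T4RecentScale.density_sandwich` (node U5b), in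
place of `factorSandwich_of_inner` (whose pointwise inner sandwich fails on a sharp letter's shell). [folklore] -/
theorem factorSandwich_of_profiledInner (hχ : ∀ i ∈ fac, LipProfile (χ i) (κ i) (L i))
    (hθ : ∀ i ∈ fac, 0 < θ i) (hρ : ∀ i ∈ fac, 0 ≤ ρ i)
    (hmeas : ∀ v ∈ Adm, ∀ i ∈ fac, Measurable (uA i v) ∧ Measurable (uB i v))
    (hint : ∀ v ∈ Adm, ∀ i ∈ fac, Integrable (GA i v) (ν i) ∧ Integrable (GB i v) (ν i))
    (hpos : ∀ v ∈ Adm, ∀ i ∈ fac, 0 ≤ᵐ[ν i] GA i v)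
    (hclose : ∀ v ∈ Adm, ∀ i ∈ fac, ∀ᵐ x ∂(ν i), |uA i v x - uB i v x| ≤ ρ i * θ i)
    (hsw : ∀ v ∈ Adm, ∀ i ∈ fac, (∀ᵐ x ∂(ν i), Real.exp (c i - r i) * GA i v x ≤ GB i v x) ∧
      (∀ᵐ x ∂(ν i), GB i v x ≤ Real.exp (c i + r i) * GA i v x))
    (hf : ∀ i ∈ fac, L i * ρ i < f i ∧ 0 < f i)
    (hfloor : ∀ v ∈ Adm, ∀ i ∈ fac,
      f i * (∫ x, smallInd (uA i v x) ((1 + ρ i) * θ i) * GA i v x ∂(ν i)) ≤ (∫ x, χ i (uA i v x / θ i) * GA i v x ∂(ν i))) :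
    FactorSandwich Adm fac (fun i v => (∫ x, χ i (uA i v x / θ i) * GA i v x ∂(ν i)))
      (fun i v => (∫ x, χ i (uB i v x / θ i) * GB i v x ∂(ν i))) c
      (fun i => r i + Real.log (f i / (f i - L i * ρ i))) := by
  intro v hv i hi
  obtain ⟨hmA, hmB⟩ := hmeas v hv i hi
  obtain ⟨hIA, hIB⟩ := hint v hv i hi
  obtain ⟨hl, hu⟩ := hsw v hv i hi
  have hPA0 : 0 ≤ (∫ x, χ i (uA i v x / θ i) * GA i v x ∂(ν i)) := by
    refine integral_nonneg_of_ae ?_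
    filter_upwards [hpos v hv i hi] with x hx
    exact mul_nonneg ((hχ i hi).nonneg _) hx
  exact ⟨hPA0, perf_sandwich_exp (hχ i hi) (hθ i hi) (hρ i hi) hmA hmB hIA hIB (hpos v hv i hi) (hclose v hv i hi)
    hl hu (hf i hi).2 (hf i hi).1 (hfloor v hv i hi)⟩

/-- THE RADIUS IS A RATE: `log(f/(f − Lρ)) ≤ Lρ/(f − Lρ)` (so with `ρ = ρ_j = (C/θmin)ϑ^j` of node U1b and `f ≥ f₀ > Lρ̄`
uniformly, the per-letter surcharge is `≤ const·ϑ^j`, summable in the level). [folklore] -/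
theorem radius_le_rate {Lv ρv fv : ℝ} (hf : 0 < fv) (hx : Lv * ρv < fv) :
    Real.log (fv / (fv - Lv * ρv)) ≤ Lv * ρv / (fv - Lv * ρv) :=
  log_div_sub_le hf hx

end Ledger

/-! ## §4 (v1.1, append-only) The NORMALISED carrier: a ratio of two performed values sharing the profiled letter -/

section Normalised

variable {Ω : Type*} [MeasurableSpace Ω] {ν : Measure Ω}
  {χ : ℝ → ℝ} {κ L θ ρ f f' c c' r r' : ℝ} {uA uB GA GB HA HB : Ω → ℝ}

/-- Two-sided bounds pass to a quotient: `e^{a}x ≤ y ≤ e^{b}x`, `e^{a'}x' ≤ y' ≤ e^{b'}x'`, `x' , y' > 0`, `x ≥ 0` ⇒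
`e^{a − b'}(x/x') ≤ y/y' ≤ e^{b − a'}(x/x')`. [folklore] -/
theorem div_sandwich {x y x' y' a b a' b' : ℝ} (hx : 0 ≤ x) (hx' : 0 < x') (hy' : 0 < y')
    (h1 : Real.exp a * x ≤ y) (h2 : y ≤ Real.exp b * x) (h3 : Real.exp a' * x' ≤ y') (h4 : y' ≤ Real.exp b' * x') :
    Real.exp (a - b') * (x / x') ≤ y / y' ∧ y / y' ≤ Real.exp (b - a') * (x / x') := by
  have hy'1 : y' ≤ Real.exp b' * x' := h4
  have hy'2 : Real.exp a' * x' ≤ y' := h3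
  constructor
  · -- e^{a-b'} x/x' = (e^a x)/(e^{b'} x') ≤ y / y'
    rw [Real.exp_sub, div_mul_div_comm]
    calc Real.exp a * x / (Real.exp b' * x') ≤ y / (Real.exp b' * x') :=
          div_le_div_of_nonneg_right h1 (by positivity)
      _ ≤ y / y' := by
          apply div_le_div_of_nonneg_left ((mul_nonneg (Real.exp_nonneg _) hx).trans h1) hy' hy'1
  · rw [Real.exp_sub, div_mul_div_comm]
    calc y / y' ≤ Real.exp b * x / y' := div_le_div_of_nonneg_right h2 hy'.le
      _ ≤ Real.exp b * x / (Real.exp a' * x') :=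
          div_le_div_of_nonneg_left (mul_nonneg (Real.exp_nonneg _) hx) (by positivity) hy'2

/-- **THE NORMALISED PERFORMED LETTER** (species (ii) of skeleton leaf L12: a letter inside a NORMALISED positive operation,
the `(T′1)⁻¹T′` TYPE of [Balaban1989LargeFieldII] (1.103) — TEMPLATE only).  Numerator `∫ χ(u^X/θ)·G^X dν` and denominator
`∫ χ(u^X/θ)·H^X dν` share the profiled letter; rests sandwiched a.e. with `(c, r)` resp. `(c', r')`, sup-closeness
`|u^A − u^B| ≤ ρθ` a.e., plateau floors `f` (for `G^A`) and `f'` (for `H^A`) with `Lρ < f, f'`, and POSITIVE denominators ⇒ the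
two runs' normalised values are sandwiched with constant `c − c'` and radius
`(r + log(f/(f−Lρ))) + (r' + log(f'/(f'−Lρ)))` — the radius DOUBLES, the floor is still needed (twice); NO anti-concentration.
[folklore] -/
theorem perf_ratio_sandwich (h : LipProfile χ κ L) (hθ : 0 < θ) (hρ : 0 ≤ ρ)
    (huA : Measurable uA) (huB : Measurable uB) (hGA : Integrable GA ν) (hGB : Integrable GB ν) (hGA0 : 0 ≤ᵐ[ν] GA)
    (hHA : Integrable HA ν) (hHB : Integrable HB ν) (hHA0 : 0 ≤ᵐ[ν] HA)
    (hclose : ∀ᵐ ω ∂ν, |uA ω - uB ω| ≤ ρ * θ)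
    (hGlo : ∀ᵐ ω ∂ν, Real.exp (c - r) * GA ω ≤ GB ω) (hGhi : ∀ᵐ ω ∂ν, GB ω ≤ Real.exp (c + r) * GA ω)
    (hHlo : ∀ᵐ ω ∂ν, Real.exp (c' - r') * HA ω ≤ HB ω) (hHhi : ∀ᵐ ω ∂ν, HB ω ≤ Real.exp (c' + r') * HA ω)
    (hf : 0 < f) (hLρ : L * ρ < f) (hfloor : f * (∫ ω, smallInd (uA ω) ((1 + ρ) * θ) * GA ω ∂ν) ≤ (∫ ω, χ (uA ω / θ) * GA ω ∂ν))
    (hf' : 0 < f') (hLρ' : L * ρ < f')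
    (hfloor' : f' * (∫ ω, smallInd (uA ω) ((1 + ρ) * θ) * HA ω ∂ν) ≤ (∫ ω, χ (uA ω / θ) * HA ω ∂ν))
    (hposA : 0 < ∫ ω, χ (uA ω / θ) * HA ω ∂ν) (hposB : 0 < ∫ ω, χ (uB ω / θ) * HB ω ∂ν) :
    Real.exp ((c - c') - ((r + Real.log (f / (f - L * ρ))) + (r' + Real.log (f' / (f' - L * ρ))))) *
        ((∫ ω, χ (uA ω / θ) * GA ω ∂ν) / (∫ ω, χ (uA ω / θ) * HA ω ∂ν)) ≤
      (∫ ω, χ (uB ω / θ) * GB ω ∂ν) / (∫ ω, χ (uB ω / θ) * HB ω ∂ν) ∧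
    (∫ ω, χ (uB ω / θ) * GB ω ∂ν) / (∫ ω, χ (uB ω / θ) * HB ω ∂ν) ≤
      Real.exp ((c - c') + ((r + Real.log (f / (f - L * ρ))) + (r' + Real.log (f' / (f' - L * ρ))))) *
        ((∫ ω, χ (uA ω / θ) * GA ω ∂ν) / (∫ ω, χ (uA ω / θ) * HA ω ∂ν)) := by
  obtain ⟨hGl, hGu⟩ := perf_sandwich_exp h hθ hρ huA huB hGA hGB hGA0 hclose hGlo hGhi hf hLρ hfloor
  obtain ⟨hHl, hHu⟩ := perf_sandwich_exp h hθ hρ huA huB hHA hHB hHA0 hclose hHlo hHhi hf' hLρ' hfloor'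
  have hnum0 : 0 ≤ ∫ ω, χ (uA ω / θ) * GA ω ∂ν := by
    refine integral_nonneg_of_ae ?_
    filter_upwards [hGA0] with ω hω
    exact mul_nonneg (h.nonneg _) hω
  have := div_sandwich hnum0 hposA hposB hGl hGu hHl hHu
  have e1 : c - (r + Real.log (f / (f - L * ρ))) - (c' + (r' + Real.log (f' / (f' - L * ρ)))) =
      (c - c') - ((r + Real.log (f / (f - L * ρ))) + (r' + Real.log (f' / (f' - L * ρ)))) := by ring
  have e2 : c + (r + Real.log (f / (f - L * ρ))) - (c' - (r' + Real.log (f' / (f' - L * ρ)))) =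
      (c - c') + ((r + Real.log (f / (f - L * ρ))) + (r' + Real.log (f' / (f' - L * ρ)))) := by ring
  rw [e1, e2] at this
  exact this

end Normalised

end Summit.QuantumFields.BalabanUV.T4Continuum.NE7cSmoothingPerformed

end
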